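import Summits.BirchSwinnertonDyer.Rank1Residual.P2.CongruentNumberSilentEvenFiveThetaDisplay
import Summits.BirchSwinnertonDyer.Rank1Residual.P2.CongruentNumberSilentEvenFiveThetaFourTorsion
import HarnessLib
import HarnessLib.Audit.Tags

/-!
# Cell «bsd-monsky» (prover-B): route B's display pushed down to the CM points — `Z(N) = Σ_{t ∈ Φ₀} z_N^t`,
# TYZ Thm. 3.6 (2) for the lift `θ` of `σ_{1+ϖ}`, the class-field-theory values of `θ`, and the sub-block Galois
# facts — and PROOF-B Lemma 5 (B0), (B1) DERIVED in the kernel; nothing asserted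

HONEST FRAMING (cell `bsd-monsky`, run/shared/lean/pub/bsd-monsky/; README §1): this file asserts NO arithmetic fact.
It refines the hypothesis package `K_B` of route B (`thetaGenusPointDatum p q`, file
`P2/CongruentNumberSilentEvenFiveThetaDisplay.lean`: TYZ data `D` + PROOF-B's Lemma 4–5 OUTPUT `thetaSpec D θ`) into a
package `thetaCMDatum p q` whose conjuncts are statements of [TianYuanZhang2017] §3 about the CM POINTS, read on the
displayed data `D : GenusPointData (2pq)` (`ℍ′_N =: H`, Galois over `ℚ`, so `Gal` below means `H ≃ₐ[ℚ] H`):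

* (D1) the genus point IS the `Φ₀`-sum: `Z(N) = Σ_{t ∈ Φ₀} z_N^t` for a CM point `z_N ∈ A(ℍ′_N)` and a finite set `Φ₀` of
  (lifts to `ℍ′_N` of) representatives of `2Cl′_N/⟨σ⟩`, of cardinality `g(N) = #2Cl_N` (TYZ p0011 L13, L53–L58: definition);
* (D2) `Φ₀ ⊂ Cl′_N = Gal(H′_N/K_N(i))` fixes `i` (p0011 L1–L2: definition of `Cl′_n`, `K′_n = K_n(i)` for `n ≡ 6`);
* (D3) `θ` = a lift of `σ_{1+ϖ} ∈ Gal(H′_N/K_N)`: `θ(√−N) = √−N`, and TYZ **Thm. 3.6 (2)**: `z_N^{σ_{1+ϖ}} = z_N + τ((1−i)/2)`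
  (p0012 L31–L33; `z_N ∈ A(H′_N)`, so the lift acts as `σ_{1+ϖ}`), displayed modulo `ℤτ(1)` so that it does not depend on
  the display's WLOG choices `im = ±i`, `τ(1/2) = (2, ±4)` (`τ((1−i)/2)` and `τ((1+i)/2)` differ by `τ(1)`);
* (D4) `Gal(H′_N/K_N)` is ABELIAN (`H′_N` = the ring class field of conductor `4`, TYZ Prop. 3.2 (2), p0010 L111–L113):
  `t(θ(z_N)) = θ(t(z_N))` for `t ∈ Φ₀` (both lifts fix `K_N`; `z_N` has coordinates in `H′_N`);
* (D5) class field theory for `θ` (PROOF-B Lemma 4 (θ1): `σ_x|_{ℚ^{ab} ∩ ·} = r(N_{K/ℚ}x)`, the rule TYZ use at p0020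
  L61–L62, with `N(1+ϖ) = 1 + N ≡ 7 (mod 8)` and the Hilbert symbols `(7,−1)₂ = −1`, `(7,−2)₂ = −1`, `(7,p)₂ = +1`,
  `(7,−q)₂ = +1`): `θ(i) = −i`, `θ(√−2) = −√−2`, `θ(√p) = √p` (`√p := i·√−p`), `θ(√−q) = √−q`;
* (D6) the sub-block genus points lie in `A` of the genus field: `Z(pq) ∈ A(L_{pq})`, `L_{pq} = ℚ(√p, √−q)` (`q ≡ 3 (8)`;
  `pq ≡ 7 (8)`, `H′ = H`, `σ = 1`, `Φ₀ = 2Cl_{pq} = Gal(H_{pq}/L_{pq})`, TYZ p0020 L55–L56), resp. `Z(q) ∈ A(K_q)` (`q ≡ 7 (8)`)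
  — displayed as invariance under every `g ∈ Gal(ℍ′_N/ℚ)` fixing `√p, √−q` resp. `√−q` (PROOF-B Lemma 1 / (B2));
* (D7) (`q ≡ 3 (8)`) every `g ∈ Gal(ℍ′_N/ℚ)` with `g|_{L_p} = c|_{L_p}` (`g(i) = −i`, `g(√p) = √p`; `L_p = ℚ(i, √p)`) satisfies
  `g(Z(p)) ∈ −Z(p) + ℤτ(1)` — TYZ **Thm. 3.6 (1)** (`z̄_p = −z_p + τ(1)`, `z_p^{σ²_ϖ} = z_p + τ(1)`, p0012 L27–L29) with
  `Gal(H′_p/L_p) = 2Cl′_p` (p0020 L55–L56) and `Gal(H′_p/ℚ)` dihedral (p0015 L106–L110): `g|_{H′_p} = c·x`, `x ∈ 2Cl′_p`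
  permutes `Φ₀^{(p)}` modulo `⟨σ⟩`, `c` inverts it (PROOF-B Lemma 5 (B3), the derivation displayed as its conclusion for
  every such `g`, not only for `θ`).

§2 then DERIVES PROOF-B Lemma 5 (B0)+(B1) in the kernel — `(θ − 1)Z(N) = g(N)·w`, `w = τ((1−i)/2)`, `2w = 0`,
`θw + w = τ(1)` — from (D1)–(D4) (`θ Σ_t z^t = Σ_t θ z^t = Σ_t t(z + w) = Z(N) + #Φ₀·w` modulo `ℤτ(1)`, since `t(w) = w`, `t(τ(1)) = τ(1)`
by (D2), and `θ[i] = −[i]θ` by (D5)), obtains (θ2) from (D5) by the kernel theorem of `…ThetaFourTorsion.lean`, reads (B2),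
(B3) off (D6), (D7) at `g = θ`, and concludes `thetaCMDatum p q → thetaGenusPointDatum p q`: the REMAINING kernel debt of
route B is exactly (D1)–(D7) = TYZ Prop. 3.2 (2) / Thm. 3.6 (1)(2) / the definition of `Z` / class field theory, each a
printed statement or a one-paragraph printed derivation (docstrings carry the locators). Compare the typer's display
`galoisFacts`/`thm28_*` for route A. `thetaCMDatum` is tagged `@[conjecture]` (an obligation node; NOT a Literature fact:
the conjunction is assembled by the cell, its discharge = displaying the CM points `z_n = f_n(P_n)` themselves).
Nothing booked; no mark moved.

References: HOME/proof/PROOF-B.md §2.3, §4, §7 (Lemmas 4, 5), §12 R1; [TianYuanZhang2017] Prop. 3.2, Thm. 3.6, §3.1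
(p0010 L99–L115, p0011 L1–L73, p0012 L22–L36), p0020 L55–L62; lit: HOME/lit/tyz2017/TYZ2017-STATEMENTS.md (+ ADDENDUM 4).
-/

noncomputable section

open scoped Classical

open WeierstrassCurve WeierstrassCurve.Affine Literature.NumberTheory.EllipticCurves
  Literature.NumberTheory.EllipticCurves.TianYuanZhang2017
  Literature.NumberTheory.EllipticCurves.TianYuanZhang2017.W2

set_option autoImplicit false

namespace Summit.BirchSwinnertonDyer.Rank1Residual.P2

open ThetaDescent

/-! ## §1 The CM-level display -/

/-- **Route B's display at the level of the CM points** (see the module docstring for (D1)–(D7) and their printed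
sources): on TYZ's data `D` for `N = 2pq` there are a CM point `z_N ∈ A(ℍ′_N)`, a finite set `Φ₀ ⊂ Gal(ℍ′_N/ℚ)` (lifted
representatives of `2Cl′_N/⟨σ⟩`, `#Φ₀ = g(N)`) with `Z(N) = Σ_{t∈Φ₀} z_N^t`, and a lift `θ` of `σ_{1+ϖ}` with TYZ
Thm. 3.6 (2) `θ(z_N) = z_N + τ((1−i)/2)` (read modulo `ℤτ(1)`, WLOG-invariant), commuting with `Φ₀` on `z_N` (`Gal(H′_N/K_N)` abelian), with the class-field-theory
values `θ(i) = −i`, `θ(√−2) = −√−2`, `θ(i√−p) = i√−p`, `θ(√−q) = √−q`; the sub-block genus point `Z(pq)` (resp. `Z(q)`)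
is fixed by every automorphism fixing `√p, √−q` (resp. `√−q`); and (`q ≡ 3 (8)`) every automorphism acting on
`L_p = ℚ(i, √p)` as complex conjugation sends `Z(p)` into `−Z(p) + ℤτ(1)` (TYZ Thm. 3.6 (1) + `Gal(H′_p/L_p) = 2Cl′_p`).
A predicate; nothing asserted.
[cite: TianYuanZhang2017, §3.1 (p0011 L1–L13, L53–L58), Prop. 3.2 (2) (p0010 L111–L113), Thm. 3.6 (1)(2) (p0012 L22–L36), proof of Lemma 3.21 (p0020 L55–L62)] -/
def thetaCMSpec {p q : ℕ} (D : GenusPointData (2 * (p * q))) : Prop :=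
  ∃ (zN : APoint D.H) (Φ₀ : Finset (D.H ≃ₐ[ℚ] D.H)) (θ : D.H ≃ₐ[ℚ] D.H),
    -- (D1) `Z(N) = Σ_{t ∈ Φ₀} z_N^t`, `#Φ₀ = g(N)`
    D.Z (2 * (p * q)) = ∑ t ∈ Φ₀, thetaPt D t zN ∧ Φ₀.card = gK (2 * (p * q)) ∧
    -- (D2) `Φ₀ ⊂ Gal(H′_N/K_N(i))` fixes `i`
    (∀ t ∈ Φ₀, t D.im = D.im) ∧
    -- (D3) `θ` lifts `σ_{1+ϖ} ∈ Gal(H′_N/K_N)`; Thm. 3.6 (2) `z^{σ_{1+ϖ}} = z + τ((1−i)/2)`, displayed modulo `ℤτ(1)`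
    --      (`τ((1∓i)/2)` differ by `τ(1)`: invariant under the display's WLOG choices `im = ±i`, `τ(1/2) = (2, ±4)`, `Z ↦ −Z`)
    θ (D.sqrtNeg (2 * (p * q))) = D.sqrtNeg (2 * (p * q)) ∧
      (∃ m₀ : ℤ, thetaPt D θ zN = zN + D.tauHalfOneMinusI + m₀ • tauOne) ∧
    -- (D4) `Gal(H′_N/K_N)` abelian, on `z_N`
    (∀ t ∈ Φ₀, thetaPt D t (thetaPt D θ zN) = thetaPt D θ (thetaPt D t zN)) ∧
    -- (D5) class field theory: `θ|_{ℚ(i,√2,√p,√q)} = r₂(7)`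
    θ D.im = -D.im ∧ θ (D.sqrtNeg 2) = -D.sqrtNeg 2 ∧ θ (D.im * D.sqrtNeg p) = D.im * D.sqrtNeg p ∧
      θ (D.sqrtNeg q) = D.sqrtNeg q ∧
    -- (D6) `Z(pq) ∈ A(L_{pq})` (Case I) / `Z(q) ∈ A(K_q)` (Case II)
    (q % 8 = 3 → ∀ g : D.H ≃ₐ[ℚ] D.H, g (D.im * D.sqrtNeg p) = D.im * D.sqrtNeg p → g (D.sqrtNeg q) = D.sqrtNeg q →
      thetaPt D g (D.Z (p * q)) = D.Z (p * q)) ∧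
    (q % 8 = 7 → ∀ g : D.H ≃ₐ[ℚ] D.H, g (D.sqrtNeg q) = D.sqrtNeg q → thetaPt D g (D.Z q) = D.Z q) ∧
    -- (D7) `g|_{L_p} = c|_{L_p}` ⟹ `g Z(p) ∈ −Z(p) + ℤτ(1)` (Case I)
    (q % 8 = 3 → ∀ g : D.H ≃ₐ[ℚ] D.H, g D.im = -D.im → g (D.im * D.sqrtNeg p) = D.im * D.sqrtNeg p →
      ∃ m : ℤ, thetaPt D g (D.Z p) + D.Z p = m • tauOne)

/-- **Route B's hypothesis package at the CM level**, at the pair `(p, q)`: TYZ data `D` for `N = 2pq` with `D.Printed`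
and `thetaCMSpec D`. An obligation node (`@[conjecture]`: unproved in the tree; its discharge = displaying the CM points
`z_n = f_n(P_n)`, the groups `Cl′_n` and the Artin map, and reading (D1)–(D7) off [TianYuanZhang2017] §3); NOT a
Literature fact. [cite: TianYuanZhang2017, §3 (Prop. 3.2, Thm. 3.5, Thm. 3.6, Lemma 3.18, Lemma 3.21)] -/
@[conjecture] def thetaCMDatum (p q : ℕ) : Prop :=
  ∃ D : GenusPointData (2 * (p * q)), D.Printed ∧ thetaCMSpec D

/-! ## §2 PROOF-B Lemma 5 (B0), (B1) derived; the CM-level package implies the `θ`-package -/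

namespace ThetaDescent

variable {n : ℕ}

/-- An automorphism fixing `i` commutes with `[i]` on `A(ℍ′_n)` (`[i](X, Y) = (−X, iY)`). [cite: TianYuanZhang2017, §3.1 (p0011 L66)] -/
theorem thetaPt_iPt_of_fix (D : GenusPointData n) (t : D.H ≃ₐ[ℚ] D.H) (hti : t D.im = D.im) (Q : APoint D.H) :
    thetaPt D t (D.iPt Q) = D.iPt (thetaPt D t Q) := by
  rcases Q with _ | ⟨x, y, h⟩
  · show thetaPt D t (D.iPt 0) = D.iPt (thetaPt D t 0)
    simp only [map_zero]
  · change Point.map t.toAlgHom (cmI D.im D.im_sq (.some x y h)) =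
      cmI D.im D.im_sq (Point.map t.toAlgHom (.some x y h))
    rw [cmI_some, Point.map_some, Point.map_some, cmI_some]
    have hi : (t.toAlgHom : D.H → D.H) D.im = D.im := hti
    simp only [map_neg, map_mul, hi]

/-- An automorphism fixing `i` fixes `w = τ((1−i)/2) = τ(1/2) − [i]τ(1/2)` (a point of `A(ℚ(i))`).
[cite: TianYuanZhang2017, §3.2 (p0012 L8–L18), Lemma 3.16 (p0017 L98–L101)] -/
theorem thetaPt_tauHalfOneMinusI_of_fix (D : GenusPointData n) (t : D.H ≃ₐ[ℚ] D.H) (hti : t D.im = D.im) :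
    thetaPt D t D.tauHalfOneMinusI = D.tauHalfOneMinusI := by
  show thetaPt D t (tauHalf - D.iPt tauHalf) = tauHalf - D.iPt tauHalf
  rw [map_sub, thetaPt_iPt_of_fix D t hti, (thetaPt_tauOne_tauHalf D t).2]

/-- **(B0) in the kernel**: for `θ(i) = −i`, `w = τ((1−i)/2)` satisfies `2w = 0` and `θw + w = τ(1)`
(`θw = τ(1/2) + [i]τ(1/2)`). [cite: TianYuanZhang2017, Thm. 3.6 (2) (p0012 L31–L33), §3.2 (p0012 L8–L18)] -/
theorem bZero (D : GenusPointData n) (θ : D.H ≃ₐ[ℚ] D.H) (hθi : θ D.im = -D.im) :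
    (2 : ℕ) • D.tauHalfOneMinusI = 0 ∧ thetaPt D θ D.tauHalfOneMinusI + D.tauHalfOneMinusI = tauOne := by
  refine ⟨(tau_facts D).2.2.2.1, ?_⟩
  show thetaPt D θ (tauHalf - D.iPt tauHalf) + (tauHalf - D.iPt tauHalf) = tauOne
  rw [map_sub, thetaPt_iPt D θ hθi, (thetaPt_tauOne_tauHalf D θ).2, ← two_nsmul_tauHalf, two_nsmul]
  abel

/-- **(B1) in the kernel**: `(θ − 1)Z(N) = #Φ₀·w` from (D1)–(D4) — `θ Σ_{t∈Φ₀} z^t = Σ_t t(θ z) = Σ_t (t z + t w)` with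
`t(w) = w`. [cite: TianYuanZhang2017, §3.1 (p0011 L53–L58), Prop. 3.2 (2) (p0010 L111–L113), Thm. 3.6 (2) (p0012 L31–L33)] -/
theorem bOne (D : GenusPointData n) (θ : D.H ≃ₐ[ℚ] D.H) (zN w : APoint D.H) (Φ₀ : Finset (D.H ≃ₐ[ℚ] D.H))
    (h36 : thetaPt D θ zN = zN + w) (htw : ∀ t ∈ Φ₀, thetaPt D t w = w)
    (hcomm : ∀ t ∈ Φ₀, thetaPt D t (thetaPt D θ zN) = thetaPt D θ (thetaPt D t zN)) :
    thetaPt D θ (∑ t ∈ Φ₀, thetaPt D t zN) - ∑ t ∈ Φ₀, thetaPt D t zN = (Φ₀.card : ℤ) • w := by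
  rw [map_sum, ← Finset.sum_sub_distrib]
  have hterm : ∀ t ∈ Φ₀, thetaPt D θ (thetaPt D t zN) - thetaPt D t zN = w := by
    intro t ht
    rw [← hcomm t ht, h36, map_add, htw t ht, add_sub_cancel_left]
  rw [Finset.sum_congr rfl hterm, Finset.sum_const, natCast_zsmul]

end ThetaDescent

/-- **The CM-level package implies the `θ`-package**: `thetaCMSpec D ⟹ ∃ θ, thetaSpec D θ` — (θ0) = (D3); (θ1) = (D5);
(θ2) by the kernel theorem `exists_map_sub_eq_zsmul_of_four_nsmul_eq_zero` from `θ(i) = −i`, `θ(√2) = √2`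
(`√2 = i√−2`); (B0)+(B1) by `bZero`/`bOne` with `w = τ((1−i)/2)`; (B2) = (D6) at `g = θ`; (B3) = (D7) at `g = θ`.
[cite: TianYuanZhang2017, Prop. 3.2 (2), Thm. 3.6 (1)(2), §3.1 (p0011 L53–L58), Lemma 3.16–3.17] -/
theorem exists_thetaSpec_of_thetaCMSpec {p q : ℕ} (hp : p.Prime) (hq : q.Prime) (D : GenusPointData (2 * (p * q)))
    (h : thetaCMSpec D) : ∃ θ : D.H ≃ₐ[ℚ] D.H, thetaSpec D θ := by
  obtain ⟨zN, Φ₀, θ, hZ, hcard, hfix, hθK, ⟨m₀, h36⟩, hcomm, hθi, hθ2, hθp, hθq, hD6I, hD6II, hD7⟩ := h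
  have hN0 : 2 * (p * q) ≠ 0 := Nat.mul_ne_zero two_ne_zero (Nat.mul_ne_zero hp.ne_zero hq.ne_zero)
  refine ⟨θ, hθK, hθi, ?_, ?_, fun hq3 => hD6I hq3 θ hθp hθq, fun hq7 => hD6II hq7 θ hθq,
    fun hq3 => hD7 hq3 θ hθi hθp⟩
  · -- (θ2) from `θ(i) = −i`, `θ(√2) = √2` with `√2 := i·√−2`
    have h2N : 2 ∈ (2 * (p * q)).divisors := Nat.mem_divisors.mpr ⟨Dvd.intro _ rfl, hN0⟩
    have hsq2 : D.sqrtNeg 2 ^ 2 = -((2 : ℕ) : D.H) := D.sqrtNeg_sq 2 h2N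
    have hs : (D.im * D.sqrtNeg 2) ^ 2 = 2 := by
      rw [mul_pow, D.im_sq, hsq2]; push_cast; ring
    have hθi' : θ.toAlgHom D.im = -D.im := hθi
    have hθs : θ.toAlgHom (D.im * D.sqrtNeg 2) = D.im * D.sqrtNeg 2 := by
      show θ (D.im * D.sqrtNeg 2) = D.im * D.sqrtNeg 2
      rw [map_mul, hθi, hθ2]; ring
    intro t ht
    exact exists_map_sub_eq_zsmul_of_four_nsmul_eq_zero θ.toAlgHom D.im (D.im * D.sqrtNeg 2) D.im_sq hs hθi' hθs t ht
  · -- (B0)+(B1) with `w = τ((1−i)/2)`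
    obtain ⟨hw2, hww⟩ := bZero D θ hθi
    have htw : ∀ t ∈ Φ₀, thetaPt D t (D.tauHalfOneMinusI + m₀ • tauOne) = D.tauHalfOneMinusI + m₀ • tauOne := by
      intro t ht
      rw [map_add, map_zsmul, thetaPt_tauHalfOneMinusI_of_fix D t (hfix t ht), (thetaPt_tauOne_tauHalf D t).1]
    refine ⟨D.tauHalfOneMinusI, Or.inl hw2, hww, (Φ₀.card : ℤ) * m₀, ?_⟩
    rw [hZ, bOne D θ zN _ Φ₀ (by rw [h36, add_assoc]) htw hcomm, hcard, smul_add, smul_smul]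

/-- **`thetaCMDatum p q ⟹ thetaGenusPointDatum p q`**: route B's kernel debt is now (D1)–(D7) of `thetaCMSpec`
(TYZ Prop. 3.2 (2), Thm. 3.6 (1)(2), the definition of `Z`, class field theory). [cite: TianYuanZhang2017, §3] -/
theorem thetaGenusPointDatum_of_thetaCMDatum {p q : ℕ} (hp : p.Prime) (hq : q.Prime) (h : thetaCMDatum p q) :
    thetaGenusPointDatum p q := by
  obtain ⟨D, hD, hCM⟩ := h
  exact ⟨D, hD, exists_thetaSpec_of_thetaCMSpec hp hq D hCM⟩

end Summit.BirchSwinnertonDyer.Rank1Residual.P2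

end
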